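import Literature.MathematicalPhysics.QuantumFieldTheory.Balaban1983to89.B7Eq136SecondOrder
import Literature.MathematicalPhysics.QuantumFieldTheory.Balaban1983to89.B11SchwarzRemainder

/-!
# `Balaban1983to89.B7Eq136Expansion` — T. Bałaban, *Averaging operations for lattice gauge theories*, Commun. Math. Phys. **98** (1985)
17–51 [Balaban1985Averaging], (136) p. 39: **«C_k(U₀, A) = C_k^{(2)}(U₀, A) + C_k^{(3)}(U₀, A) + …» QUANTITATIVELY** — along every complex
slice `t ↦ C_j(U₀, tB)(c)` the second-order term `C_j⁽²⁾(U₀, B)(c)` of `B7Eq136SecondOrder` IS the `t²`-coefficient (r08's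
`B11SchwarzRemainder.leadCoeff … 2`), it obeys (135) «|C_k(U₀, A)| ≦ C₂|A|²» itself, and the remainder after it is CUBIC with an explicit
constant: `‖C_j(U₀, B)(c) − C_j⁽²⁾(U₀, B)(c)‖ ≤ 2C₂(Lʲ)²b⁻¹‖B‖³_∞` — the inputs «C2, c₂, K₃» of [B11] (56) / [B12] p. 266

statement-level skeleton of published theorems with citation tags; proofs where landed; nothing here is a claim about the Yang–Mills mass gap

PDF held: `paper:balaban1985-cmp98-averaging` (journal page = PDF page + 16), renders `…/1985-cmp98-averaging-p022-x2.png`, `-p023-x2.png`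
(pp. 38–39) read as images; `paper:balaban1985-cmp102-variational-background` p. 286 [PDF 10] (text layer); `paper:balaban1987-cmp109-rg-i-small-field`
p. 266 [PDF 18] (text layer `p0018.txt`).

CITATION HEADER / WHAT IS REPRODUCED.  Cell `lit-balaban`, Phase-2 proof seat p06 gen 5 = unit `lit-balaban-p06` (TAKING line HOME/STATUS.md
2026-08-21T07:19:10Z; file 2 of the `C_j⁽²⁾` lane); SKELETON rows **B7.Prop4 / B7.Eq127** (displays (135)–(136); owner r04) and **B11.Eq55**
((55)–(56); owner r08: the HYPOTHESES `C2`, `c₂`, `K₃` («‖C(Y) − C2 Y Y‖ ≤ K₃‖Y‖³ … what the Cauchy estimates give for an analytic C = Σ_{n≥2}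
C^{(n)}; HYPOTHESES here») of `B11Eq56Expansion`, and the slice readings `reading_C2_of_135` / `reading_D3` of `B11SchwarzRemainder`).
THE PRINT.  [B7] p. 38: *«Q_k(U₀, ηA) = Q_k(U₀)A + C_k(U₀, A), (134) and |C_k(U₀, A)| ≦ C₂|A|² < C₂α₁². (135)»*; p. 39: *«The function C_k can be
decomposed further into a sum of homogeneous polynomials, C_k(U₀, A) = C_k^{(2)}(U₀, A) + C_k^{(3)}(U₀, A) + … . (136)»*; (137) *«dF(A, δA) =
(d/dt)F(A + tδA)|_{t=0}»*.  [B11] p. 286: *«C_j(…) = Σ_{n=2}^∞ C_j^{(n)}(…) (56) where C_j^{(n)}, D^{(n)} are homogeneous polynomials of n-th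
order»*.  [B12] p. 266: *«we decompose the function D into the sum D^{(2)} + D₃, where D^{(2)} is the second order term equal to C^{(2)}, and
D₃ is the higher order remainder.»*  The quantitative versions below (the constant of (135) for `C^{(2)}` alone; the cubic remainder with its
constant) are printed nowhere; they are what the Cauchy estimate along slices gives (cell GAPS G-adv2-29 (ii) zone, `B11SchwarzRemainder`).

DICTIONARY.  As `B7Eq136SecondOrder`: `C_j(U₀, B)(c)` ↦ `CCovIter L U₀ B j z κ`, `C_j⁽²⁾(U₀, B)(c)` ↦ `CCovIter2 L U₀ B j z κ := ½·(d²/dt²)C_j(U₀,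
tB)(c)|₀`; here `B` is ANY bond field on `ℤᵈ` with `‖B_b‖ ≤ β` (no finite variable set needed: everything is read on the slice `t ↦ tB`, `t ∈
ℂ`); print's `C₂` ↦ the constant of `B7Eq123General.prop4_general` (i), `C₂ = 8·C₁·e^{4cα₀}`, `C₁ = 131072(d+1)²`, `c = 800(d+1)²(d+4)`, written
out; `|A|` ↦ `Lʲβ` (the field on the `L^{−j}`-lattice).  Regime = Prop. 4's at a general background (`B7Eq123General.prop4_general`: `L ≥ 2`,
`AvgClosed` structure group, (52) `pdev U₀ < α₀L^{−2k}`, `C₀α₀ ≤ ⅓`, `4α₀ ≤ c₂′`) at a witness radius `b > 0` (`hsmall`, `2Lᵏb ≤ c₃`); the slice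
through `B` is read on the disc `|t| < b/β`.

WHAT THIS FILE PROVES (theorems only; kernel, 0 sorry, standard axioms), for `j ≤ k`, `0 < β`, `‖B_b‖ ≤ β`:
* §0 (private, [folklore]) `leadCoeff φ 2 = ½·φ″(0)` for `φ` analytic at `0` (r08's divided-slope coefficient vs. the Taylor coefficient:
  Mathlib `has_fpower_series_iterate_dslope_fslope`, `coeff_iterate_fslope`, `HasFPowerSeriesOnBall.factorial_smul`); the smallness of the regime
  is monotone in the radius.
* §1 `analyticAt_CCovIter_slice` (the slice is analytic at every `t` with `|t|β ≤ b`), `differentiableOn_CCovIter_slice` (on the disc `|t| < b/β`),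
  `norm_CCovIter_slice_le` ((135) along the slice: `‖C_j(U₀, tB)(c)‖ ≤ C₂(Lʲβ)²|t|²`).
* §2 **`CCovIter2_eq_leadCoeff`**: `C_j⁽²⁾(U₀, B)(c) = leadCoeff (t ↦ C_j(U₀, tB)(c)) 2` — the object of `B7Eq136SecondOrder` IS r08's slice
  coefficient `a₂`; **`tendsto_CCovIter2`**: `t⁻²C_j(U₀, tB)(c) → C_j⁽²⁾(U₀, B)(c)` as `t → 0` («a second order term in the expansion»);
  **`norm_CCovIter2_le_C2`**: `‖C_j⁽²⁾(U₀, B)(c)‖ ≤ C₂(Lʲβ)²` — (135) FOR `C^{(2)}` (`reading_C2_of_135` made concrete; `c₂`);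
  **`norm_CCovIter_sub_CCovIter2_slice_le`**: `‖C_j(U₀, tB)(c) − t²C_j⁽²⁾(U₀, B)(c)‖ ≤ 2C₂(Lʲ)²β³b⁻¹|t|³` on `|t| < b/β`;
  **`norm_CCovIter_sub_CCovIter2_le`**: for `β < b`, `‖C_j(U₀, B)(c) − C_j⁽²⁾(U₀, B)(c)‖ ≤ 2C₂(Lʲ)²b⁻¹β³` — (136) beyond second order is CUBIC
  (`K₃ = 2C₂(Lʲ)²/b`).
NOT CLAIMED: the individual higher terms `C^{(n)}`, `n ≥ 3`, and convergence of (136) (r04 `B7Prop4GeneralCk.prop4_general_Ck_powerSeries`);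
optimality of the constants.
-/

noncomputable section

open scoped BigOperators Topology
open NormedSpace Finset Metric Filter

namespace Literature.MathematicalPhysics.QuantumFieldTheory.Balaban1983to89.B7Eq136Expansion

open B7Prop1Explicit B7Prop1Local B7Prop2Explicit B7Prop3Flat B7Prop4Flat B7Eq92Concrete B7Prop3GeneralLinear
  B7Prop4GeneralLevels B7Prop5GeneralInduction B7Prop5GeneralLevels B7Eq136SecondOrder
open B7Prop6GeneralAnalytic (prop4_general_analyticAt)
open B7Prop4GeneralCk (linCovIter_csmul)
open B11SchwarzRemainder (tail leadCoeff tendsto_leadCoeff norm_leadCoeff_le_of_pow_bound norm_sub_leadCoeff_le_of_pow_bound_two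
  OrderGe)

-- `Site` alone would resolve to the torus sites of `Setup.lean`; re-export the `ℤ^d` sites of `B7Prop1Explicit`.
export B7Prop1Explicit (Site)

variable {d : ℕ}

/-! ## §0 The divided-slope coefficient `a₂` is the Taylor coefficient `½φ″(0)` (generic, private) -/

section Coeff

variable {F : Type*} [NormedAddCommGroup F] [NormedSpace ℂ F] [CompleteSpace F]

/-- for `φ : ℂ → F` analytic at `0`, r08's `leadCoeff φ 2` (the value at `0` of the twice-iterated divided slope) is the Taylor
coefficient `½·φ″(0)`. [folklore] -/
private theorem leadCoeff_two_eq_half_iteratedDeriv {φ : ℂ → F} (hφ : AnalyticAt ℂ φ 0) :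
    leadCoeff φ 2 = (2 : ℂ)⁻¹ • iteratedDeriv 2 φ 0 := by
  obtain ⟨q, r, hr⟩ := hφ
  have hq : HasFPowerSeriesAt φ q 0 := ⟨r, hr⟩
  -- `leadCoeff φ 2 = q.coeff 2`
  have h1 : HasFPowerSeriesAt (tail φ 2) (FormalMultilinearSeries.fslope^[2] q) 0 :=
    hq.has_fpower_series_iterate_dslope_fslope 2
  have h2 : leadCoeff φ 2 = q.coeff 2 := by
    have h := h1.coeff_zero 1
    rw [← FormalMultilinearSeries.coeff_iterate_fslope 2 0]
    exact h.symm
  -- `2! • q.coeff 2 = φ″(0)`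
  have h3 : (2 : ℕ).factorial • q 2 (fun _ => (1 : ℂ)) = iteratedFDeriv ℂ 2 φ 0 (fun _ => 1) := hr.factorial_smul 1 2
  have h4 : q.coeff 2 = q 2 (fun _ => (1 : ℂ)) := rfl
  rw [h2, h4, iteratedDeriv_eq_iteratedFDeriv, ← h3, Nat.factorial_two, ← Nat.cast_smul_eq_nsmul ℂ, smul_smul]
  norm_num

end Coeff

/-! ## §1 The slice `t ↦ C_j(U₀, tB)(c)`: analyticity and (135) along it -/

section Regime

variable {𝔸 : Type*} [NormedRing 𝔸] [NormedAlgebra ℂ 𝔸] [CompleteSpace 𝔸] [NormOneClass 𝔸]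

/-- the smallness hypotheses of Prop. 4 are monotone in the radius (private arithmetic). [folklore] -/
private theorem smallness_mono {L k d : ℕ} {α₀ b b' : ℝ} (hbb : b' ≤ b)
    (hsmall : Real.exp (4 * (800 * ((d : ℝ) + 1) ^ 2 * ((d : ℝ) + 4)) * α₀)
      * (1 + 8 * (131072 * ((d : ℝ) + 1) ^ 2) * ((L : ℝ) ^ k * b)) ≤ 2)
    (hc₃ : 2 * ((L : ℝ) ^ k * b) ≤ c3 d L) :
    Real.exp (4 * (800 * ((d : ℝ) + 1) ^ 2 * ((d : ℝ) + 4)) * α₀)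
        * (1 + 8 * (131072 * ((d : ℝ) + 1) ^ 2) * ((L : ℝ) ^ k * b')) ≤ 2 ∧
      2 * ((L : ℝ) ^ k * b') ≤ c3 d L := by
  have hLk : (0 : ℝ) ≤ (L : ℝ) ^ k := by positivity
  have hm : (L : ℝ) ^ k * b' ≤ (L : ℝ) ^ k * b := mul_le_mul_of_nonneg_left hbb hLk
  refine ⟨?_, by linarith⟩
  have hexp : 0 ≤ Real.exp (4 * (800 * ((d : ℝ) + 1) ^ 2 * ((d : ℝ) + 4)) * α₀) := (Real.exp_pos _).le
  have h1 : 1 + 8 * (131072 * ((d : ℝ) + 1) ^ 2) * ((L : ℝ) ^ k * b')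
      ≤ 1 + 8 * (131072 * ((d : ℝ) + 1) ^ 2) * ((L : ℝ) ^ k * b) := by
    have : 0 ≤ 8 * (131072 * ((d : ℝ) + 1) ^ 2) := by positivity
    nlinarith
  exact (mul_le_mul_of_nonneg_left h1 hexp).trans hsmall

variable (L : ℕ) (hL : 2 ≤ L) {G : Subgroup 𝔸ˣ} (hG : AvgClosed d L G) (k : ℕ)
  (U₀ : Site d → Fin d → 𝔸ˣ) (hU₀ : ∀ x κ, U₀ x κ ∈ G) {α₀ : ℝ} (hα : 0 < α₀)
  (hα3 : C0 d * α₀ ≤ 1 / 3) (hα4 : 4 * α₀ ≤ c2' d L) (h52 : pdev U₀ < α₀ * (((L : ℝ) ^ k)⁻¹) ^ 2)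
  {b : ℝ} (hb : 0 < b)
  (hsmall : Real.exp (4 * (800 * ((d : ℝ) + 1) ^ 2 * ((d : ℝ) + 4)) * α₀)
    * (1 + 8 * (131072 * ((d : ℝ) + 1) ^ 2) * ((L : ℝ) ^ k * b)) ≤ 2)
  (hc₃ : 2 * ((L : ℝ) ^ k * b) ≤ c3 d L)
  {B : Site d → Fin d → 𝔸} {β : ℝ} (hβ : 0 < β) (hB : ∀ x κ, ‖B x κ‖ ≤ β)

/-- print's `C₂` of (135) at a general background (`B7Eq123General.prop4_general` (i)): `8·C₁·e^{4cα₀}`. -/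
local notation "C₂" => (8 * (131072 * ((d : ℝ) + 1) ^ 2) * Real.exp (4 * (800 * ((d : ℝ) + 1) ^ 2 * ((d : ℝ) + 4)) * α₀))

omit [CompleteSpace 𝔸] [NormOneClass 𝔸] in
include hB in
/-- the entries of `tB` are bounded by `|t|β`. [folklore] -/
private theorem norm_smul_entry_le (t : ℂ) (x : Site d) (κ : Fin d) : ‖(t • B) x κ‖ ≤ ‖t‖ * β := by
  rw [Pi.smul_apply, Pi.smul_apply, norm_smul]
  exact mul_le_mul_of_nonneg_left (hB x κ) (norm_nonneg t)

include hL hG hU₀ hα hα3 hα4 h52 hsmall hc₃ hβ hB in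
/-- **THE SLICE `t ↦ C_j(U₀, tB)(c)` IS ANALYTIC** at every `t` with `|t|β ≤ b`, `j ≤ k` (Prop. 4's analyticity at a general background
along the linear family `t ↦ tB`, `B7Prop6GeneralAnalytic.prop4_general_analyticAt`, minus the `ℂ`-homogeneous linear part
`B7Prop4GeneralCk.linCovIter_csmul`). [cite: Balaban1985Averaging, Prop. 4 p.38, (134) p.38, (137) p.39] -/
theorem analyticAt_CCovIter_slice {j : ℕ} (hj : j ≤ k) (z : Site d) (κ : Fin d) {t₀ : ℂ} (ht₀ : ‖t₀‖ * β ≤ b) :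
    AnalyticAt ℂ (fun t : ℂ => CCovIter L U₀ (t • B) j z κ) t₀ := by
  obtain ⟨hs, hc⟩ := smallness_mono (L := L) (k := k) (d := d) (α₀ := α₀) ht₀ hsmall hc₃
  have hlog : AnalyticAt ℂ (fun t : ℂ => logCovIter L U₀ (t • B) j z κ) t₀ :=
    prop4_general_analyticAt L hL hG k U₀ hU₀ hα hα3 hα4 h52 (fun t : ℂ => t • B)
      (fun x κ' => by
        have : (fun t : ℂ => (t • B) x κ') = fun t : ℂ => t • B x κ' := rfl
        rw [this]; exact analyticAt_id.smul analyticAt_const)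
      (by positivity) (fun x κ' => norm_smul_entry_le hB t₀ x κ') hs hc j hj z κ
  have hlin : AnalyticAt ℂ (fun t : ℂ => linCovIter L U₀ (t • B) j z κ) t₀ := by
    have hfun : (fun t : ℂ => linCovIter L U₀ (t • B) j z κ) = fun t : ℂ => t • linCovIter L U₀ B j z κ := by
      funext t
      rw [linCovIter_csmul L hL hG k U₀ hU₀ hα hα3 hα4 h52 t B j hj]; rfl
    rw [hfun]; exact analyticAt_id.smul analyticAt_const
  exact hlog.sub hlin

include hL hG hU₀ hα hα3 hα4 h52 hsmall hc₃ hβ hB in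
/-- the slice is (complex-)differentiable on the disc `|t| < b/β`. [cite: Balaban1985Averaging, Prop. 4 p.38, (137) p.39] -/
theorem differentiableOn_CCovIter_slice {j : ℕ} (hj : j ≤ k) (z : Site d) (κ : Fin d) :
    DifferentiableOn ℂ (fun t : ℂ => CCovIter L U₀ (t • B) j z κ) (ball 0 (b / β)) := fun t ht => by
  have ht' : ‖t‖ * β ≤ b := by
    rw [mem_ball_zero_iff] at ht
    exact (le_div_iff₀ hβ).1 ht.le
  exact (analyticAt_CCovIter_slice L hL hG k U₀ hU₀ hα hα3 hα4 h52 hsmall hc₃ hβ hB hj z κ ht').differentiableAt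
    |>.differentiableWithinAt

include hL hG hU₀ hα hα3 hα4 h52 hsmall hc₃ hβ hB in
/-- **(135) ALONG THE SLICE**: `‖C_j(U₀, tB)(c)‖ ≤ C₂·(Lʲβ)²·|t|²` for `|t| < b/β` (`B7Eq123General.prop4_general` (i) at the field `tB` of
size `|t|β`). [cite: Balaban1985Averaging, (135) p.38, (130) p.38] -/
theorem norm_CCovIter_slice_le {j : ℕ} (hj : j ≤ k) (z : Site d) (κ : Fin d) {t : ℂ} (ht : t ∈ ball (0 : ℂ) (b / β)) :
    ‖CCovIter L U₀ (t • B) j z κ‖ ≤ C₂ * ((L : ℝ) ^ j * β) ^ 2 * ‖t‖ ^ 2 := by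
  have ht' : ‖t‖ * β ≤ b := by
    rw [mem_ball_zero_iff] at ht
    exact (le_div_iff₀ hβ).1 ht.le
  obtain ⟨hs, hc⟩ := smallness_mono (L := L) (k := k) (d := d) (α₀ := α₀) ht' hsmall hc₃
  have h := (B7Eq123General.prop4_general L hL hG k U₀ hU₀ hα hα3 hα4 h52 (t • B) (by positivity)
    (fun x κ' => norm_smul_entry_le hB t x κ') hs hc j hj).1 z κ
  refine h.trans (le_of_eq ?_)
  ring

/-! ## §2 `C_j⁽²⁾` is the `t²`-coefficient; (135) for `C^{(2)}`; the cubic remainder -/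

include hL hG hU₀ hα hα3 hα4 h52 hb hsmall hc₃ hβ hB in
/-- **`C_j⁽²⁾(U₀, B)(c)` IS THE `t²`-COEFFICIENT OF THE SLICE** — the second-order term of `B7Eq136SecondOrder` equals r08's divided-slope
coefficient `leadCoeff (t ↦ C_j(U₀, tB)(c)) 2` of `B11SchwarzRemainder` (so the readings `reading_C2_of_135` / `reading_D3` there speak
about THIS object). [cite: Balaban1985Averaging, (136) p.39] [cite: Balaban1985Variational, (56) p.286] -/
theorem CCovIter2_eq_leadCoeff {j : ℕ} (hj : j ≤ k) (z : Site d) (κ : Fin d) :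
    CCovIter2 L U₀ B j z κ = leadCoeff (fun t : ℂ => CCovIter L U₀ (t • B) j z κ) 2 := by
  rw [CCovIter2_def, leadCoeff_two_eq_half_iteratedDeriv]
  exact analyticAt_CCovIter_slice L hL hG k U₀ hU₀ hα hα3 hα4 h52 hsmall hc₃ hβ hB hj z κ (by simpa using hb.le)

include hL hG hU₀ hα hα3 hα4 h52 hb hsmall hc₃ hβ hB in
/-- **«A SECOND ORDER TERM IN THE EXPANSION»**: `t⁻²·C_j(U₀, tB)(c) → C_j⁽²⁾(U₀, B)(c)` as `t → 0`, `t ≠ 0` — with `C_j(U₀, 0) = 0`,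
`DC_j(U₀, 0) = 0` this is «C_k = C_k^{(2)} + (higher order)» read on the slice. [cite: Balaban1985Averaging, (136) p.39]
[cite: Balaban1985BackgroundPropagators, (3.127) p.421] -/
theorem tendsto_CCovIter2 {j : ℕ} (hj : j ≤ k) (z : Site d) (κ : Fin d) :
    Tendsto (fun t : ℂ => (t ^ 2)⁻¹ • CCovIter L U₀ (t • B) j z κ) (𝓝[≠] (0 : ℂ)) (𝓝 (CCovIter2 L U₀ B j z κ)) := by
  have hr : 0 < b / β := div_pos hb hβ
  have hd := differentiableOn_CCovIter_slice L hL hG k U₀ hU₀ hα hα3 hα4 h52 hsmall hc₃ hβ hB hj z κ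
  have hKb : ∀ t ∈ ball (0 : ℂ) (b / β), ‖CCovIter L U₀ (t • B) j z κ‖ ≤ C₂ * ((L : ℝ) ^ j * β) ^ 2 * ‖t‖ ^ 2 :=
    fun t ht => norm_CCovIter_slice_le L hL hG k U₀ hU₀ hα hα3 hα4 h52 hsmall hc₃ hβ hB hj z κ ht
  have hM : ∀ t ∈ ball (0 : ℂ) (b / β), ‖CCovIter L U₀ (t • B) j z κ‖ ≤ C₂ * ((L : ℝ) ^ j * β) ^ 2 * (b / β) ^ 2 := by
    intro t ht
    have ht' : ‖t‖ < b / β := mem_ball_zero_iff.mp ht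
    exact (hKb t ht).trans (mul_le_mul_of_nonneg_left (pow_le_pow_left₀ (norm_nonneg t) ht'.le 2) (by positivity))
  rw [CCovIter2_eq_leadCoeff L hL hG k U₀ hU₀ hα hα3 hα4 h52 hb hsmall hc₃ hβ hB hj z κ]
  exact tendsto_leadCoeff hr hd hM (OrderGe.of_bound_on_ball hr hKb)

include hL hG hU₀ hα hα3 hα4 h52 hb hsmall hc₃ hβ hB in
/-- **(135) FOR THE SECOND-ORDER TERM**: `‖C_j⁽²⁾(U₀, B)(c)‖ ≤ C₂·(Lʲβ)²` («|C^{(2)}(X)| ≦ C₂|X|²», r08's `reading_C2_of_135` made concrete: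
the Cauchy estimate of the `t²`-coefficient of a slice bounded by `C₂(Lʲβ)²|t|²`). [cite: Balaban1985Averaging, (135) p.38, (136) p.39] -/
theorem norm_CCovIter2_le_C2 {j : ℕ} (hj : j ≤ k) (z : Site d) (κ : Fin d) :
    ‖CCovIter2 L U₀ B j z κ‖ ≤ C₂ * ((L : ℝ) ^ j * β) ^ 2 := by
  have hr : 0 < b / β := div_pos hb hβ
  rw [CCovIter2_eq_leadCoeff L hL hG k U₀ hU₀ hα hα3 hα4 h52 hb hsmall hc₃ hβ hB hj z κ]
  exact norm_leadCoeff_le_of_pow_bound hr (by positivity)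
    (differentiableOn_CCovIter_slice L hL hG k U₀ hU₀ hα hα3 hα4 h52 hsmall hc₃ hβ hB hj z κ)
    (fun t ht => norm_CCovIter_slice_le L hL hG k U₀ hU₀ hα hα3 hα4 h52 hsmall hc₃ hβ hB hj z κ ht)

include hL hG hU₀ hα hα3 hα4 h52 hb hsmall hc₃ hβ hB in
/-- **THE REMAINDER AFTER THE SECOND-ORDER TERM IS CUBIC, along the slice**: for `|t| < b/β`,
`‖C_j(U₀, tB)(c) − t²·C_j⁽²⁾(U₀, B)(c)‖ ≤ 2C₂(Lʲ)²β³b⁻¹·|t|³` («C_k^{(3)}(U₀, A) + …», the Schwarz-lemma step of `B11SchwarzRemainder` at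
the radius `b/β`). [cite: Balaban1985Averaging, (136) p.39] [cite: Balaban1985Variational, (56) p.286] -/
theorem norm_CCovIter_sub_CCovIter2_slice_le {j : ℕ} (hj : j ≤ k) (z : Site d) (κ : Fin d) {t : ℂ}
    (ht : t ∈ ball (0 : ℂ) (b / β)) :
    ‖CCovIter L U₀ (t • B) j z κ - t ^ 2 • CCovIter2 L U₀ B j z κ‖ ≤
      2 * (C₂ * ((L : ℝ) ^ j) ^ 2 * β ^ 3 * b⁻¹) * ‖t‖ ^ 3 := by
  have hr : 0 < b / β := div_pos hb hβ
  rw [CCovIter2_eq_leadCoeff L hL hG k U₀ hU₀ hα hα3 hα4 h52 hb hsmall hc₃ hβ hB hj z κ]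
  have h := norm_sub_leadCoeff_le_of_pow_bound_two hr (by positivity)
    (differentiableOn_CCovIter_slice L hL hG k U₀ hU₀ hα hα3 hα4 h52 hsmall hc₃ hβ hB hj z κ)
    (fun t ht => norm_CCovIter_slice_le L hL hG k U₀ hU₀ hα hα3 hα4 h52 hsmall hc₃ hβ hB hj z κ ht) ht
  refine h.trans (le_of_eq ?_)
  have hβ0 : β ≠ 0 := hβ.ne'
  rw [inv_div, mul_pow, div_eq_mul_inv]
  field_simp

include hL hG hU₀ hα hα3 hα4 h52 hb hsmall hc₃ hβ hB in
/-- **(136) BEYOND SECOND ORDER IS CUBIC**: for a field `B` with `‖B_b‖ ≤ β < b`,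
`‖C_j(U₀, B)(c) − C_j⁽²⁾(U₀, B)(c)‖ ≤ 2C₂(Lʲ)²b⁻¹·β³` — «D = D^{(2)} + D₃ … D₃ is the higher order remainder» with the constant `K₃ = 2C₂(Lʲ)²/b`
of `B11Eq56Expansion`'s hypothesis `h3`, concretely. [cite: Balaban1985Averaging, (136) p.39] [cite: Balaban1985Variational, (56) p.286]
[cite: Balaban1987RG1, p.266] -/
theorem norm_CCovIter_sub_CCovIter2_le {j : ℕ} (hj : j ≤ k) (z : Site d) (κ : Fin d) (hβb : β < b) :
    ‖CCovIter L U₀ B j z κ - CCovIter2 L U₀ B j z κ‖ ≤ 2 * (C₂ * ((L : ℝ) ^ j) ^ 2 * b⁻¹) * β ^ 3 := by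
  have h1 : (1 : ℂ) ∈ ball (0 : ℂ) (b / β) := by
    rw [mem_ball_zero_iff, norm_one]
    exact (one_lt_div hβ).2 hβb
  have h := norm_CCovIter_sub_CCovIter2_slice_le L hL hG k U₀ hU₀ hα hα3 hα4 h52 hb hsmall hc₃ hβ hB hj z κ h1
  rw [one_smul, one_pow, one_smul, norm_one] at h
  refine h.trans (le_of_eq ?_)
  ring

end Regime

end Literature.MathematicalPhysics.QuantumFieldTheory.Balaban1983to89.B7Eq136Expansion

end
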